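import Summits.QuantumFields.BalabanUV.T4Continuum.Support.AveragingDeficitLiftPeriodic

/-!
# T⁴ programme, node NE3 (η-rate of the minimisers) — THE ACTION SANDWICH, part 1: LEVELS.
# The one-step average read on the next lattice, the `k`-fold average (43), the level-`k` Wilson action of a
# periodic configuration, and the DEFICIT IDENTITY between consecutive level actions

Sixteenth generation of the NE3 prover lineage P1 of the cell `pub-balaban` (unit `b2b-balaban-t4-ne3-p1`, OWNER of
`BINDER-OWNERS.md` row NE3), file 1 of the «action sandwich» series.  CONTEXT.  NE3 (T4-DAG node U1b) asks for the
η-RATE of Bałaban's constrained minimisers `U_k(V)` (B11 = CMP 102 (1985) 277–309, (5)–(8)): consecutive runs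
(`k` steps at spacing `η = L^{−k}`, `k + 1` steps at `η/L`, same unit-lattice datum `V`) compared through the minimal
ACTION VALUES (`T4EtaRateMin.ActionRate`) and through LOCAL readings (`LocalRate`).  Row NE3-R2 PROVED the periodic
value wall β′-per of the energy route (`T4AveragingDeficitNonAbelian.abs_deficit_torus_le`: for every `U(N)`-valued
`(L·M)`-periodic `V` in the small-field class, `|𝓓_{period}(V)| ≤ wallConstNA(d,L)·(‖∇_V F‖²_{ℓ²} + a³M^d)`, where
`𝓓 = L^{d−4}·A(avg V) − A(V)` is the AVERAGING DEFICIT of the Wilson action, `T4AveragingDeficitWall.deficit`).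
OBSERVATION OF THIS SERIES (the «sandwich re-cut» of NE3(A)): for the ACTION reading no response ∕ convexity ∕
Fermat ∕ lift ∕ propagator input is needed at all — if `U_{k+1}` minimises run B, its one-step average COMPETES in
run A, so `A_k ≤ A_{k+1} + η′^{d−4}𝓓(U_{k+1})`; if `Ũ` is any admissible configuration of run B whose one-step average
IS the run-A minimiser `U_k`, then `A_{k+1} ≤ A_k − η′^{d−4}𝓓(Ũ)`; hence `|A_k − A_{k+1}| ≤ η′^{d−4}·max|𝓓|`, and
β′-per + the printed-TYPE regularity of the two competitors ((8)–(10) of B11 Thm 1) give the rate `L^{−2}`.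
THIS FILE supplies the level bookkeeping on the tree's own objects (B7 = CMP 98 (1985): `B7Prop1Explicit.bavg` (42),
`B7Prop2Explicit.rescale`∕`avgIter` (43); B11 (5): `T4AveragingDeficitWall.fineAction`∕`coarseAction`∕`deficit`):
 * §1 the ONE-STEP AVERAGE READ ON THE NEXT LATTICE `rescale L (bavg L U)` and the tree's `k`-fold average `avgIter`:
   `avgIter_rescale_bavg` (`Ū^{k+1} = \overline{(Ū)}^{k}` — the composition law that makes the averaged finer
   configuration ADMISSIBLE one level down), `fhol_rescale_bavg` (its unit plaquette variables ARE the coarse plaquette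
   variables `chol` of the deficit), `fineAction_rescale_bavg` (its fine Wilson action on a window IS the deficit's
   `coarseAction`);
 * §2 CLASS TRANSPORT: periodicity (`isPeriodicCfg_rescale`, `isPeriodicCfg_bavg`, `isPeriodicCfg_rescale_bavg`, from
   the tree's translation covariance `AveragingDeficitLiftPeriodic.bavg_shift`), unitarity (`isUnitaryCfg_rescale_bavg`,
   from `B7Prop2Explicit.bavg_mem_unitaryUnits` + `norm_Wcx_sub_one_le`) and the small-field class
   (`smallField_rescale_bavg`: B7 Prop. 1 (51) = tree `B7Prop1Explicit.prop1_explicit`, `a ↦ L²a + 226(8(d+1)(d+4)L²a)²`);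
 * §3 non-negativity of the Wilson weight on `U(N)` (`wt_nonneg_of_unitary`, `fineAction_nonneg`);
 * §4 the LEVEL-`k` ACTION of an `(N·L^k)`-periodic configuration, `levelAction L N k U = (L^{4−d})^k · Σ_{p ⊂ [0,NL^k)^d}
   (1 − Re tr U(∂p))` (B11 (5) with `η = L^{−k}`, one fundamental domain), `levelAction_nonneg`, and THE DEFICIT IDENTITY
   **`levelAction_rescale_bavg_sub`**: `levelAction L N k (rescale L (bavg L U)) − levelAction L N (k+1) U
   = (L^{4−d})^{k+1} · deficit L U (blockWindow L (periodBox (N·L^k)))`.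
Parts 2–3 (`MinimalActionSandwich`, `MinimalActionRate`) build the sandwich and the `ActionRate` theorem on top.

HONEST FRAMING.  Finite-T⁴ ultraviolet bookkeeping about MINIMISERS (rung (B)+1 of the cell's ladder); nothing here
is an estimate; no conditional of the cell (`BetaPertH`, (B), (B^μ)) is used or hidden; nothing bears on infinite
volume, a mass gap, or the Clay problem; NE3 is NOT proved by this file.  ABSOLUTE RULE of the cell kept: no printed
sentence is a hypothesis of any declaration; the manuscripts under audit are quoted for what they DEFINE ((42), (43),
(5)); inputs are kernel-proved tree modules only; no `sorry`, no axioms beyond Mathlib's.  PLACEMENT (human rule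
2026-08-19): cell work under `Summits/QuantumFields/BalabanUV/`; imports the accepted `Support.AveragingDeficitLiftPeriodic`
(p203095) only; moves nothing.  Records: `t4/T4-EST-U1b-OSC.md` v1.34, `t4/T4-EST-NE3-P1.md` v2.33 of the cell `pub-balaban`.
-/

set_option autoImplicit false

open scoped BigOperators Matrix Matrix.Norms.L2Operator
open NormedSpace Finset

namespace Summit.QuantumFields.BalabanUV.T4Continuum.MinimalActionLevels

open Literature.MathematicalPhysics.QuantumFieldTheory.Balaban1983to89
open B7Prop1Explicit B7Prop2Explicit MatrixLog UnitaryModel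
open T4AveragingDeficitWall hiding Site Plane Plaq Bond
open T4AveragingDeficitWallBoundary (IsPeriodicCfg periodBox blockSites_periodBox mem_periodBox card_periodBox)
open AveragingDeficitTransport (mem_U1_of_unitary)
open AveragingDeficitLiftPeriodic (bavg_shift)

noncomputable section

variable {d : ℕ} {n : Type*} [Fintype n] [DecidableEq n]

local notation "𝕄" => Matrix n n ℂ
local notation "Site" => B7Prop1Explicit.Site

/-! ## §1 The one-step average read on the next lattice and the `k`-fold average (43) -/

/-- **THE COMPOSITION LAW OF THE ITERATED AVERAGE**: `avgIter L (rescale L (bavg L U)) k = avgIter L U (k + 1)` —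
the `k`-fold average of the (rescaled) one-step average is the `(k+1)`-fold average.  With the tree's definition (43)
`avgIter L U (j+1) = rescale L (bavg L (avgIter L U j))` this is an induction on `k`.  It is what makes the averaged
run-B minimiser an ADMISSIBLE configuration of run A (same `k`-fold average = the datum).
[cite: Balaban1985Averaging, (43) p.24] -/
theorem avgIter_rescale_bavg (L : ℕ) (U : Site d → Fin d → 𝕄ˣ) :
    ∀ k : ℕ, avgIter L (rescale L (bavg L U)) k = avgIter L U (k + 1)
  | 0 => rfl
  | k + 1 => by rw [avgIter_succ, avgIter_rescale_bavg L U k]; rfl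

/-- The unit plaquette variables of the rescaled configuration are the `L`-plaquette variables of the original at the
corners `L·y` (the tree's `hol_rescale_plaqWord`, in the deficit's vocabulary `fhol`). [folklore] -/
theorem fhol_rescale (L : ℕ) (W : Site d → Fin d → 𝕄ˣ) (P : T4AveragingDeficitWall.Plaq d) :
    fhol (rescale L W) P = cplaq L W ((L : ℤ) • P.1) P.2.1.1 P.2.1.2 := by
  unfold fhol
  exact hol_rescale_plaqWord L W P.1 P.2.1.1 P.2.1.2

/-- **The unit plaquette variables of `rescale L (bavg L U)` ARE the coarse plaquette variables `chol L U` of the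
deficit.** [folklore] -/
theorem fhol_rescale_bavg (L : ℕ) (U : Site d → Fin d → 𝕄ˣ) (P : T4AveragingDeficitWall.Plaq d) :
    fhol (rescale L (bavg L U)) P = chol L U P := by
  rw [fhol_rescale]; rfl

/-- **The fine Wilson action of `rescale L (bavg L U)` on a window IS the deficit's coarse action of `U` on that
window**: `Σ_{P ∈ W} (1 − Re tr \overline{U}(∂P))`. [folklore] -/
theorem fineAction_rescale_bavg (L : ℕ) (U : Site d → Fin d → 𝕄ˣ) (Wc : Finset (T4AveragingDeficitWall.Plaq d)) :
    fineAction (rescale L (bavg L U)) Wc = coarseAction L U Wc := by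
  unfold fineAction coarseAction
  exact Finset.sum_congr rfl fun P _ => by rw [fhol_rescale_bavg]

/-! ## §2 Class transport: periodicity, unitarity, the small-field class -/

/-- Rescaling divides the period: an `(L·P)`-periodic `W` rescales to a `P`-periodic configuration. [folklore] -/
theorem isPeriodicCfg_rescale (L : ℕ) {W : Site d → Fin d → 𝕄ˣ} {P : ℤ} (hW : IsPeriodicCfg W ((L : ℤ) * P)) :
    IsPeriodicCfg (rescale L W) P := by
  intro x κ μ
  simp only [rescale_apply, smul_add, smul_smul]
  exact hW ((L : ℤ) • x) κ μ

/-- The average (42) of a `P`-periodic configuration is `P`-periodic (translation covariance of (42): the tree's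
`bavg_shift`). [cite: Balaban1985Averaging, (42) p.23] -/
theorem isPeriodicCfg_bavg (L : ℕ) {V : Site d → Fin d → 𝕄ˣ} {P : ℤ} (hV : IsPeriodicCfg V P) :
    IsPeriodicCfg (bavg L V) P :=
  fun x κ μ => bavg_shift L (fun y ν => hV y κ ν) x μ

/-- Hence `rescale L (bavg L U)` of an `(L·P)`-periodic `U` is `P`-periodic. [folklore] -/
theorem isPeriodicCfg_rescale_bavg (L : ℕ) {U : Site d → Fin d → 𝕄ˣ} {P : ℤ} (hU : IsPeriodicCfg U ((L : ℤ) * P)) :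
    IsPeriodicCfg (rescale L (bavg L U)) P :=
  isPeriodicCfg_rescale L (isPeriodicCfg_bavg L hU)

/-- The loop variables `V(Γ_{c,x})V(c)⁻¹` of (42) are within `1/4` of `1` throughout the small-field class with
`512(d+1)(d+4)L²a ≤ 1` (the tree's `norm_Wcx_sub_one_le`: `≤ 2·8(d+1)(d+4)L²a ≤ 1/32`). [cite: Balaban1985Averaging, p.25] -/
theorem norm_Wcx_sub_one_le_quarter [Nonempty n] (L : ℕ) (hL : 1 ≤ L) {U : Site d → Fin d → 𝕄ˣ}
    (hU : IsUnitaryCfg U) {a : ℝ} (ha : 0 ≤ a) (hsmall : 512 * (d + 1) * (d + 4) * (L : ℝ) ^ 2 * a ≤ 1)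
    (hUa : SmallField U a) (q : Site d) (κ : Fin d) (r : Fin d → Fin L) :
    ‖((Wcx L U q κ (boxVec L r) : 𝕄ˣ) : 𝕄) - 1‖ ≤ 1 / 4 := by
  have hU1 : ∀ x κ', U x κ' ∈ U1 𝕄 := fun x κ' => mem_U1_of_unitary (hU x κ')
  refine (norm_Wcx_sub_one_le L hL U hU1 ha hsmall hUa q κ r).trans ?_
  nlinarith

/-- **The average of a `U(N)`-valued small-field configuration is `U(N)`-valued** (tacit in print; the tree's
`bavg_mem_unitaryUnits`), hence so is its rescaling. [cite: Balaban1985Averaging, (42) p.23, (22)–(23) p.21] -/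
theorem isUnitaryCfg_rescale_bavg [Nonempty n] (L : ℕ) (hL : 1 ≤ L) {U : Site d → Fin d → 𝕄ˣ}
    (hU : IsUnitaryCfg U) {a : ℝ} (ha : 0 ≤ a) (hsmall : 512 * (d + 1) * (d + 4) * (L : ℝ) ^ 2 * a ≤ 1)
    (hUa : SmallField U a) : IsUnitaryCfg (rescale L (bavg L U)) := by
  letI : CStarAlgebra 𝕄 := {}
  intro x κ
  rw [rescale_apply]
  exact bavg_mem_unitaryUnits (fun y ν => hU y ν) L _ κ
    (norm_Wcx_sub_one_le_quarter L hL hU ha hsmall hUa _ κ)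

variable (d) in
/-- The small-field radius after one averaging step: B7 Prop. 1 (51) with the tree's explicit constants,
`a ↦ L²a + 226·(8(d+1)(d+4)L²a)²`. [cite: Balaban1985Averaging, Prop. 1 (51) p.26] -/
def avgRadius (L : ℕ) (a : ℝ) : ℝ := (L : ℝ) ^ 2 * a + 226 * (8 * (d + 1) * (d + 4) * (L : ℝ) ^ 2 * a) ^ 2

omit [Fintype n] [DecidableEq n] in
/-- `0 ≤ avgRadius d L a` for `a ≥ 0`. [folklore] -/
theorem avgRadius_nonneg (L : ℕ) {a : ℝ} (ha : 0 ≤ a) : 0 ≤ avgRadius d L a := by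
  unfold avgRadius; positivity

omit [Fintype n] [DecidableEq n] in
/-- `avgRadius` is monotone in `a ≥ 0`. [folklore] -/
theorem avgRadius_mono (L : ℕ) {a b : ℝ} (ha : 0 ≤ a) (hab : a ≤ b) : avgRadius d L a ≤ avgRadius d L b := by
  unfold avgRadius
  have h8 : 0 ≤ 8 * ((d : ℝ) + 1) * (d + 4) * (L : ℝ) ^ 2 * a := by positivity
  gcongr

/-- **B7 PROPOSITION 1 (51) AS CLASS TRANSPORT**: a `U(N)`-valued configuration in `SmallField U a` with
`512(d+1)(d+4)L²a ≤ 1` averages (and rescales) into `SmallField · (avgRadius d L a)` — the tree's kernel-checked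
`B7Prop1Explicit.prop1_explicit` at every plaquette of the `L`-lattice. [cite: Balaban1985Averaging, Prop. 1 (51) p.26] -/
theorem smallField_rescale_bavg [Nonempty n] (L : ℕ) (hL : 1 ≤ L) {U : Site d → Fin d → 𝕄ˣ} (hU : IsUnitaryCfg U)
    {a : ℝ} (ha : 0 ≤ a) (hsmall : 512 * (d + 1) * (d + 4) * (L : ℝ) ^ 2 * a ≤ 1) (hUa : SmallField U a) :
    SmallField (rescale L (bavg L U)) (avgRadius d L a) := by
  intro x κ κ' hκ
  have hU1 : ∀ y ν, U y ν ∈ U1 𝕄 := fun y ν => mem_U1_of_unitary (hU y ν)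
  rw [hol_rescale_plaqWord]
  exact prop1_explicit L hL ((L : ℤ) • x) hκ U hU1 ha hsmall hUa

/-! ## §3 The Wilson weight is non-negative on `U(N)` -/

/-- `0 ≤ 1 − Re tr W` for unitary `W` (`|Re tr W| ≤ |W| = 1`, B7 (20) + the operator norm of a unitary).
[cite: Balaban1985Averaging, (20) p.21] -/
theorem wt_nonneg_of_unitary [Nonempty n] {W : 𝕄ˣ} (hW : W ∈ unitaryUnits 𝕄) : 0 ≤ wt W := by
  letI : CStarAlgebra 𝕄 := {}
  unfold wt
  have h1 : |nReTr (W : 𝕄)| ≤ ‖(W : 𝕄)‖ := MatrixNorms.abs_nReTr_le_opNorm _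
  have h2 : ‖(W : 𝕄)‖ = 1 := CStarRing.norm_of_mem_unitary (mem_unitaryUnits.mp hW)
  have h3 := (abs_le.mp (h2 ▸ h1)).2
  linarith

/-- The fine Wilson action of a `U(N)`-valued configuration is non-negative on every window. [folklore] -/
theorem fineAction_nonneg [Nonempty n] {U : Site d → Fin d → 𝕄ˣ} (hU : IsUnitaryCfg U)
    (W : Finset (T4AveragingDeficitWall.Plaq d)) : 0 ≤ fineAction U W := by
  unfold fineAction
  exact Finset.sum_nonneg fun p _ => wt_nonneg_of_unitary (hol_mem_of hU _ _)

/-! ## §4 Level windows, level actions and the deficit identity -/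

variable (d) in
/-- All plaquettes (with ordered plane) based in the period box `[0,P)^d` — one fundamental domain of plaquettes of a
`P`-periodic configuration. [folklore] -/
def perWin (P : ℕ) : Finset (T4AveragingDeficitWall.Plaq d) := periodBox P ×ˢ Finset.univ

omit [Fintype n] [DecidableEq n] in
/-- The coarse half of the period window pair is `perWin M`. [folklore] -/
theorem blockWindow_periodBox_fst (L M : ℕ) : (blockWindow L (periodBox (d := d) M)).1 = perWin d M := rfl

omit [Fintype n] [DecidableEq n] in
/-- The fine half of the period window pair is `perWin (L·M)` (the blocks of `[0,M)^d` tile `[0,LM)^d`: the tree's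
`blockSites_periodBox`). [folklore] -/
theorem blockWindow_periodBox_snd (L M : ℕ) (hL : 1 ≤ L) :
    (blockWindow L (periodBox (d := d) M)).2 = perWin d (L * M) := by
  show blockSites L (periodBox M) ×ˢ Finset.univ = periodBox (L * M) ×ˢ Finset.univ
  rw [blockSites_periodBox L M hL]

omit [Fintype n] [DecidableEq n] in
/-- `#perWin P = P^d · #Plane d`. [folklore] -/
theorem card_perWin (P : ℕ) : (perWin d P).card = P ^ d * Fintype.card (T4AveragingDeficitWall.Plane d) := by
  unfold perWin
  rw [Finset.card_product, card_periodBox, Finset.card_univ]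

variable (d) in
/-- The per-step action weight ratio `L^{d−4}` of B11 (5) (`η^{d−4}` with `η = L^{−k}` contributes `(L^{d−4})^{−k}`).
[cite: Balaban1985Variational, (5) p.278] -/
def stepWt (L : ℕ) : ℝ := (L : ℝ) ^ ((d : ℤ) - 4)

omit [Fintype n] [DecidableEq n] in
/-- `0 < stepWt d L` for `L ≥ 1`. [folklore] -/
theorem stepWt_pos (L : ℕ) (hL : 1 ≤ L) : 0 < stepWt d L := by
  unfold stepWt
  have hL0 : (0 : ℝ) < L := by exact_mod_cast (by omega : 0 < L)
  exact zpow_pos hL0 _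

variable (d) in
/-- **THE LEVEL-`k` WILSON ACTION** of an `(N·L^k)`-periodic configuration (B11 (5) at `η = L^{−k}`, read on the unit
lattice `ℤ^d` of the DICTIONARY of `B7Prop2Explicit`, one fundamental domain):
`A^{(k)}(U) = (L^{4−d})^k · Σ_{p based in [0, N L^k)^d} (1 − Re tr U(∂p))`. [cite: Balaban1985Variational, (5) p.278] -/
def levelAction (L N k : ℕ) (U : Site d → Fin d → 𝕄ˣ) : ℝ :=
  ((stepWt d L)⁻¹) ^ k * fineAction U (perWin d (N * L ^ k))

/-- `0 ≤ levelAction` for `U(N)`-valued configurations (`L ≥ 1`). [folklore] -/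
theorem levelAction_nonneg [Nonempty n] (L N k : ℕ) (hL : 1 ≤ L) {U : Site d → Fin d → 𝕄ˣ} (hU : IsUnitaryCfg U) :
    0 ≤ levelAction d L N k U := by
  unfold levelAction
  exact mul_nonneg (pow_nonneg (inv_nonneg.mpr (stepWt_pos (d := d) L hL).le) _) (fineAction_nonneg hU _)

/-- **THE DEFICIT IDENTITY BETWEEN CONSECUTIVE LEVEL ACTIONS**: for every configuration `U` (read at level `k+1`),
`A^{(k)}(rescale L (bavg L U)) − A^{(k+1)}(U) = (L^{4−d})^{k+1} · 𝓓_{W([0, N L^k)^d)}(U)` — the level-`k` action of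
the averaged configuration minus the level-`(k+1)` action of the configuration is the AVERAGING DEFICIT of the full
period window (tree `T4AveragingDeficitWall.deficit`), up to the printed weight. [folklore] -/
theorem levelAction_rescale_bavg_sub (L N k : ℕ) (hL : 1 ≤ L) (U : Site d → Fin d → 𝕄ˣ) :
    levelAction d L N k (rescale L (bavg L U)) - levelAction d L N (k + 1) U
      = ((stepWt d L)⁻¹) ^ (k + 1) * deficit L U (blockWindow L (periodBox (N * L ^ k))) := by
  have hc : stepWt d L ≠ 0 := (stepWt_pos (d := d) L hL).ne'
  have hwin : fineAction U (perWin d (N * L ^ (k + 1))) = fineAction U (blockWindow L (periodBox (N * L ^ k))).2 := by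
    rw [blockWindow_periodBox_snd L _ hL, show L * (N * L ^ k) = N * L ^ (k + 1) by ring]
  unfold levelAction deficit
  rw [fineAction_rescale_bavg, hwin, blockWindow_periodBox_fst, pow_succ]
  unfold stepWt
  field_simp

/-- The same identity solved for the finer level: `A^{(k+1)}(U) = A^{(k)}(rescale L (bavg L U)) − (L^{4−d})^{k+1}·𝓓(U)`.
[folklore] -/
theorem levelAction_succ_eq (L N k : ℕ) (hL : 1 ≤ L) (U : Site d → Fin d → 𝕄ˣ) :
    levelAction d L N (k + 1) U
      = levelAction d L N k (rescale L (bavg L U))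
          - ((stepWt d L)⁻¹) ^ (k + 1) * deficit L U (blockWindow L (periodBox (N * L ^ k))) := by
  have h := levelAction_rescale_bavg_sub (d := d) L N k hL U
  linarith

end

end Summit.QuantumFields.BalabanUV.T4Continuum.MinimalActionLevels
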